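import Literature.AlgebraicGeometry.Resolution.LocalBlowupModels

/-!
# Every member of a tower of local blowing ups of a finitely generated model is the local ring
# of a finitely generated model

Helper file for the stub `exists_fg_model_of_tower` (bookkeeping step T1) of the line
`pfaff-line-log-final-forms` (crux `Valuative.LuAlphaPTorsor`,
item `stmt-ResolutionOfSingularities-0641`).

Setting: `K/k` fields, `O` a valuation ring of `K`, `A₀ ⊆ O` a finitely generated `k`-subalgebra
of `K`, `R₀ := locAtCentre A₀.toSubring O` its local ring at the centre of `O`
(`Literature/AlgebraicGeometry/Resolution/LocalBlowup.lean`). If `R₀ → ⋯ → B'` is a tower of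
local blowing ups with respect to `O` (`IsLocalBlowup O`), then `locAtCentre B' O` (which is `B'`
itself as soon as the tower has positive length) is again `locAtCentre A₁.toSubring O` for a
finitely generated `k`-subalgebra `A₀ ≤ A₁ ⊆ O`.

* `locAtCentre_closure_locAtCentre_union` — `((B_𝔪)[t])_𝔪 = (B[t])_𝔪` inside `K`;
* `exists_fg_model_of_tower` — the statement above.
-/

set_option linter.dupNamespace false

namespace Summit.ResolutionOfSingularities.ResolutionOfSingularities.Theorems.PfaffLine

open Literature.AlgebraicGeometry.Resolution

/-- **Localising first does not change the local blowing up**: for a subring `B` of `K` and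
`t ⊆ K`, `((B_{𝔪_O ∩ B})[t])_𝔪 = (B[t])_𝔪` inside `K`, where `(-)_𝔪 = locAtCentre (-) O`.
(`≥` by monotonicity; `≤`: `(B_𝔪)[t] ⊆ (B[t])_𝔪` generatorwise, then localise and use the
idempotence `locAtCentre_locAtCentre`.) [folklore] -/
theorem locAtCentre_closure_locAtCentre_union {K : Type*} [Field K] (O : ValuationSubring K)
    (B : Subring K) (t : Set K) :
    locAtCentre (Subring.closure ((locAtCentre B O : Set K) ∪ t)) O =
      locAtCentre (Subring.closure ((B : Set K) ∪ t)) O := by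
  refine le_antisymm ?_ ?_
  · have h1 : Subring.closure ((locAtCentre B O : Set K) ∪ t) ≤
        locAtCentre (Subring.closure ((B : Set K) ∪ t)) O := by
      refine Subring.closure_le.mpr (Set.union_subset ?_ ?_)
      · exact locAtCentre_mono O (Subring.closure_mono Set.subset_union_left |>.trans'
          (fun x hx => Subring.subset_closure hx))
      · exact fun x hx => le_locAtCentre _ O (Subring.subset_closure (Or.inr hx))
    exact (locAtCentre_mono O h1).trans (locAtCentre_locAtCentre _ O).le
  · refine locAtCentre_mono O (Subring.closure_mono ?_)
    exact Set.union_subset_union_left _ (le_locAtCentre B O)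

/-- **Every member of a tower of local blowing ups of the local ring of a finitely generated
model is the local ring of a finitely generated model.** For a finitely generated `k`-subalgebra
`A₀ ⊆ O` of `K` and a tower of local blowing ups `locAtCentre A₀ O → ⋯ → B'` with respect to
`O`, there is a finitely generated `k`-subalgebra `A₀ ≤ A₁ ⊆ O` with
`locAtCentre A₁ O = locAtCentre B' O` (namely `A₁ = A₀[t]` for the finite `t ⊆ O` of
`exists_eq_locAtCentre_of_reflTransGen`). [folklore] -/
theorem exists_fg_model_of_tower : ∀ {k K : Type} [Field k] [Field K] [Algebra k K] (O : ValuationSubring K) (A₀ : Subalgebra k K), A₀.toSubring ≤ O.toSubring → A₀.FG → ∀ (B' : Subring K), Relation.ReflTransGen (Literature.AlgebraicGeometry.Resolution.IsLocalBlowup O) (Literature.AlgebraicGeometry.Resolution.locAtCentre A₀.toSubring O) B' → ∃ (A₁ : Subalgebra k K), A₁.toSubring ≤ O.toSubring ∧ A₀ ≤ A₁ ∧ A₁.FG ∧ Literature.AlgebraicGeometry.Resolution.locAtCentre A₁.toSubring O = Literature.AlgebraicGeometry.Resolution.locAtCentre B' O := by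
  intro k K _ _ _ O A₀ hA₀ hfg B' H
  obtain ⟨-, t, ht, he⟩ := exists_eq_locAtCentre_of_reflTransGen (locAtCentre_le hA₀) H
  rw [locAtCentre_closure_locAtCentre_union] at he
  have e : Subring.closure ((A₀.toSubring : Set K) ∪ ↑t) =
      (Algebra.adjoin k ((A₀ : Set K) ∪ ↑t)).toSubring :=
    closure_subalgebra_union_eq A₀ (↑t : Set K)
  rw [e] at he
  refine ⟨Algebra.adjoin k ((A₀ : Set K) ∪ ↑t), ?_, ?_, fg_adjoin_subalgebra_union A₀ hfg t,
    he.symm⟩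
  · rw [← e]
    exact Subring.closure_le.mpr (Set.union_subset hA₀ ht)
  · exact fun x hx => Algebra.subset_adjoin (Or.inl hx)

end Summit.ResolutionOfSingularities.ResolutionOfSingularities.Theorems.PfaffLine
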